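import Literature.AlgebraicGeometry.Resolution.ImmediateRationalUniformization
import HarnessLib

/-!
# Density supplies the hypotheses of Kaplansky approximation (Knaf–Kuhlmann 2009, Lemma 3.9)

Stub D1 of the line `pfaff-line-log-final-forms` for the crux `Valuative.LuAlphaPTorsor`
(reshape v6.5, the dense-Abhyankar range of Knaf–Kuhlmann 2009, Thm. 1.5).

Ambient setting as in `Literature/AlgebraicGeometry/Resolution/ImmediateRationalUniformization.lean`:
one valued field `(Ω, V)` with `V : ValuationSubring Ω` (values multiplicative, `V.valuation`),
subfields `L ≤ F ≤ Ω`, `L(z) = Subfield.closure (L ∪ {z})`. "`F` lies in the completion of `L`"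
is rendered as DENSITY: every `x ∈ F` is approximable by elements of `L` to within the value of
any non-zero `w ∈ F`.

`stub_denseKaplansky`: if `F` is dense over `L` and `z ∈ F` is transcendental over `L`, then the
purely transcendental step `L < L(z)` satisfies the three hypotheses of KK09 Lemma 3.9
(`Literature.AlgebraicGeometry.Resolution.isSmoothlyUniformizableIn_of_immediate_of_kaplansky`):

* `hval`: every non-zero `w ∈ L(z)` has the value of an element of `L` (approximate `w` to within
  `v(w)`; ultrametric inequality);
* `hres`: every `w ∈ L(z)` is congruent to an element of `L` modulo the maximal ideal
  (approximate `w` to within `v(1) = 1`);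
* `h3` (Kaplansky's condition (3) of KK09 Lemma 2.17): for a polynomial `g` over `L` the value
  `v(g(a))` is constant for `a ∈ L` close enough to `z` — continuity of polynomial values via the
  Taylor expansion `g(a) = g(z) + Σ_{i ≥ 1} g^{[i]}(z) (a - z)ⁱ`: once `v(z - a)` is below `1` and
  below every `v(g(z)/g^{[i]}(z))`, each term `i ≥ 1` has value `< v(g(z))`, so
  `v(g(a)) = v(g(z))` (`valuation_eval_eq_of_sub_lt`).

## Source

H. Knaf, F.-V. Kuhlmann, *Every place admits local uniformization in a finite extension of the
function field*, Adv. Math. 221 (2009) 428–453 = arXiv:math/0702856: Lemma 2.16 (completion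
case), Lemma 2.17, Lemma 3.9, and the proof of Prop. 3.11 / Thm. 1.5.
-/

set_option linter.dupNamespace false

namespace Summit.ResolutionOfSingularities.ResolutionOfSingularities.Theorems.PfaffLine

open Polynomial Literature.AlgebraicGeometry.Resolution

/-- **Continuity of polynomial values** (ambient form). If `g` is a polynomial with coefficients
in a subfield `F ∋ z` of a valued field `(Ω, V)` and `g(z) ≠ 0`, then there is a non-zero
`w₀ ∈ F` such that `v(g(a)) = v(g(z))` whenever `v(z - a) < v(w₀)`: expand
`g(a) = g(z) + Σ_{i ≥ 1} cᵢ (a - z)ⁱ` (Taylor expansion at `z`, `cᵢ ∈ F`) and take for `w₀` an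
element of least value among `1` and the `g(z)/cᵢ` (`cᵢ ≠ 0`); then every term `i ≥ 1` has value
`≤ v(cᵢ) v(z - a) < v(g(z))`. [folklore] -/
theorem valuation_eval_eq_of_sub_lt {Ω : Type*} [Field Ω] (V : ValuationSubring Ω)
    (F : Subfield Ω) {g : Polynomial Ω} (hg : ∀ k, g.coeff k ∈ F) {z : Ω} (hz : z ∈ F)
    (hgz : g.eval z ≠ 0) :
    ∃ w₀ ∈ F, w₀ ≠ 0 ∧ ∀ a : Ω, V.valuation (z - a) < V.valuation w₀ →
      V.valuation (g.eval a) = V.valuation (g.eval z) := by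
  classical
  -- the Taylor coefficients `cᵢ = (taylor z g).coeff i` lie in `F`, `c₀ = g(z)`
  have hcF : ∀ i, (taylor z g).coeff i ∈ F := fun i => coeff_taylor_mem F hg hz i
  -- `d i = g(z)/cᵢ` if `cᵢ ≠ 0`, else `1`; all in `F`, non-zero, `d 0 = 1`
  obtain ⟨d, hd⟩ : ∃ d : ℕ → Ω, ∀ i, d i =
      if (taylor z g).coeff i = 0 then 1 else g.eval z / (taylor z g).coeff i := ⟨_, fun _ => rfl⟩
  have hdF : ∀ i, d i ∈ F := by
    intro i
    rw [hd]
    split_ifs with h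
    · exact F.one_mem
    · exact div_mem (by rw [← taylor_coeff_zero]; exact hcF 0) (hcF i)
  have hdne : ∀ i, d i ≠ 0 := by
    intro i
    rw [hd]
    split_ifs with h
    · exact one_ne_zero
    · exact div_ne_zero hgz h
  have hd0 : d 0 = 1 := by
    rw [hd, taylor_coeff_zero, if_neg hgz, div_self hgz]
  set N := (taylor z g).natDegree with hN
  have h0mem : 0 ∈ Finset.range (N + 1) := Finset.mem_range.mpr (Nat.succ_pos N)
  obtain ⟨i₀, -, hmin⟩ :=
    (Finset.range (N + 1)).exists_min_image (fun i => V.valuation (d i)) ⟨0, h0mem⟩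
  refine ⟨d i₀, hdF i₀, hdne i₀, fun a ha => ?_⟩
  have hvgz : V.valuation (g.eval z) ≠ 0 := (_root_.map_ne_zero _).mpr hgz
  -- `v(z - a) < 1`
  have hlt1 : V.valuation (z - a) < 1 := by
    have h := hmin 0 h0mem
    simp only [hd0, map_one] at h
    exact lt_of_lt_of_le ha h
  -- Taylor expansion: `g(a) = Σ_{i < N} c_{i+1} (a - z)^{i+1} + g(z)`
  have hexp : g.eval a = (∑ i ∈ Finset.range N,
      (taylor z g).coeff (i + 1) * (a - z) ^ (i + 1)) + g.eval z := by
    have h1 : g.eval a = (taylor z g).eval (a - z) := by rw [taylor_eval, sub_add_cancel]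
    rw [h1, eval_eq_sum_range, Finset.sum_range_succ', pow_zero, mul_one, taylor_coeff_zero]
  rw [hexp]
  refine Valuation.map_add_eq_of_lt_right _ (Valuation.map_sum_lt _ hvgz fun i hi => ?_)
  -- each term `i + 1 ≥ 1` has value `< v(g(z))`
  by_cases hci : (taylor z g).coeff (i + 1) = 0
  · rw [hci, zero_mul, map_zero]
    exact zero_lt_iff.mpr hvgz
  · have hi' : i + 1 ∈ Finset.range (N + 1) := by
      rw [Finset.mem_range] at hi ⊢
      omega
    have h2 := hmin (i + 1) hi'
    simp only [hd (i + 1), if_neg hci, map_div₀] at h2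
    have hvci : 0 < V.valuation ((taylor z g).coeff (i + 1)) :=
      zero_lt_iff.mpr ((_root_.map_ne_zero _).mpr hci)
    rw [le_div_iff₀ hvci] at h2
    rw [map_mul, map_pow, Valuation.map_sub_swap]
    calc V.valuation ((taylor z g).coeff (i + 1)) * V.valuation (z - a) ^ (i + 1)
        ≤ V.valuation ((taylor z g).coeff (i + 1)) * V.valuation (z - a) := by
          refine mul_le_mul_right ?_ _
          rw [pow_succ]
          calc V.valuation (z - a) ^ i * V.valuation (z - a) ≤ 1 * V.valuation (z - a) :=
                mul_le_mul_left (pow_le_one₀ zero_le hlt1.le) _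
            _ = V.valuation (z - a) := one_mul _
      _ < V.valuation ((taylor z g).coeff (i + 1)) * V.valuation (d i₀) :=
          mul_lt_mul_of_pos_left ha hvci
      _ = V.valuation (d i₀) * V.valuation ((taylor z g).coeff (i + 1)) := mul_comm _ _
      _ ≤ V.valuation (g.eval z) := h2

/-- Stub D1 (reshape v6.5): **density ⇒ the hypotheses of KK09 Lemma 3.9.** If `F` is dense over
`L` (every `x ∈ F` is approximable by elements of `L` to within the value of any non-zero
`w ∈ F`) and `z ∈ F` is transcendental over `L`, then `L(z)|L` is immediate in the form Lemma 3.9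
(`isSmoothlyUniformizableIn_of_immediate_of_kaplansky`) consumes (`hval`: every non-zero element
of `L(z)` has the value of an element of `L`; `hres`: every element of `O ∩ L(z)` is congruent to
an element of `L` modulo `𝔪`) and Kaplansky's condition (3) holds (`h3`: the value `v g(a)` is
constant for `a ∈ L` close enough to `z` — by continuity of polynomial values,
`valuation_eval_eq_of_sub_lt`; for `g(z) = 0` transcendence gives `g = 0`).
[cite: KnafKuhlmann2009, Lemma 2.16 (completion case) and Lemma 3.9] -/
theorem stub_denseKaplansky :
    ∀ (Ω : Type) [Field Ω] (V : ValuationSubring Ω) (L F : Subfield Ω) (z : Ω), L ≤ F → z ∈ F → (∀ x ∈ F, ∀ w ∈ F, w ≠ 0 → ∃ a ∈ L, V.valuation (x - a) < V.valuation w) → (∀ P : Polynomial Ω, (∀ k, P.coeff k ∈ L) → P.eval z = 0 → P = 0) → (∀ w ∈ Subfield.closure ((L : Set Ω) ∪ {z}), w ≠ 0 → ∃ b ∈ L, V.valuation w = V.valuation b) ∧ (∀ w ∈ Subfield.closure ((L : Set Ω) ∪ {z}), w ∈ V → ∃ c ∈ L, V.valuation (w - c) < 1) ∧ (∀ g : Polynomial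 Ω, (∀ k, g.coeff k ∈ L) → ∃ a₀ ∈ L, ∃ α : V.ValueGroup, ∀ a ∈ L, V.valuation (z - a) ≤ V.valuation (z - a₀) → V.valuation (g.eval a) = α) := by
  intro Ω _ V L F z hLF hzF hdense htrans
  -- `L(z) ≤ F`
  have hEF : Subfield.closure ((L : Set Ω) ∪ {z}) ≤ F :=
    Subfield.closure_le.mpr (Set.union_subset hLF (Set.singleton_subset_iff.mpr hzF))
  refine ⟨?_, ?_, ?_⟩
  · -- `hval`: approximate `w` to within `v(w)`
    intro w hw hw0
    obtain ⟨a, haL, hva⟩ := hdense w (hEF hw) w (hEF hw) hw0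
    refine ⟨a, haL, ?_⟩
    rw [Valuation.map_sub_swap] at hva
    exact (Valuation.map_eq_of_sub_lt _ hva).symm
  · -- `hres`: approximate `w` to within `v(1) = 1`
    intro w hw _
    obtain ⟨c, hcL, hvc⟩ := hdense w (hEF hw) 1 F.one_mem one_ne_zero
    exact ⟨c, hcL, by rwa [map_one] at hvc⟩
  · -- `h3`: continuity of polynomial values
    intro g hg
    by_cases hgz : g.eval z = 0
    · have hg0 : g = 0 := htrans g hg hgz
      refine ⟨0, L.zero_mem, 0, fun a _ _ => ?_⟩
      rw [hg0, eval_zero, map_zero]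
    · obtain ⟨w₀, hw₀F, hw₀, hcont⟩ :=
        valuation_eval_eq_of_sub_lt V F (fun k => hLF (hg k)) hzF hgz
      obtain ⟨a₀, ha₀L, hva₀⟩ := hdense z hzF w₀ hw₀F hw₀
      exact ⟨a₀, ha₀L, V.valuation (g.eval z), fun a _ ha =>
        hcont a (lt_of_le_of_lt ha hva₀)⟩

end Summit.ResolutionOfSingularities.ResolutionOfSingularities.Theorems.PfaffLine
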